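import Summits.HodgeConjecture.HodgeConjecture.Theorems.NoetherLefschetzOneUpLevelZeroNets
import Literature.AlgebraicGeometry.HodgeTheory.SaitoGrFDeRhamCurveNetHolds
import Literature.AlgebraicGeometry.HodgeTheory.ArapuraSurfaceFibredFourfoldsSplitMonodromy
import HarnessLib

/-!
# `stub_levelZeroNets` — LEVEL ZERO NETS, modulo Riemann existence and the partie fixe

Registered stub `stub_levelZeroNets` of line `birth` of crux `FourfoldsGrantedK3Nets`
(stmt-HodgeConjecture-14599, route `NoetherLefschetzOneUp` of `HodgeConjecture`). Its statement is,
BY NAME, the route's support item `LevelZeroNets` (stmt-HodgeConjecture-11602), the `g = 0` branch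
of the net trichotomy: for `X` smooth projective of dimension `4` over `ℂ` and `f : X ⟶ ℙ²`
surjective on points whose fibres over the complex points off a proper Zariski-closed `T ⊊ ℙ²` are
smooth projective surfaces admitting a Hodge model with `h^{2,0} = 0`, the span of the rational
`(2,2)`-classes of `H⁴(X(ℂ); ℂ)` lies in
`algebraicClasses X 2 ⊔ span {rational (2,2)-classes vanishing on (X ∖ f⁻¹T')(ℂ), T' ⊊ ℙ² closed}`
(D. Arapura 2022, Cor. 1.5: the Hodge conjecture for fourfolds fibred by `p_g = 0` surfaces, in
the "modulo vertical classes" form the route consumes).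

STATE OF THE TREE. The conditional theorem `Theorems.levelZeroNets_of_deligne_smoothPart`
(`Theorems/NoetherLefschetzOneUpLevelZeroNets.lean`) derives `LevelZeroNets` from two named facts:

* Deligne, *Hodge III*, Cor. 8.2.8 (`Deligne1974_ker_restrictCompl_eq_iSup_range_complexGysin`) —
  now a THEOREM of the Literature layer, `Deligne1974_ker_restrictCompl_eq_iSup_range_complexGysin_holds`
  (`HodgeTheory/SaitoGrFDeRhamCurveNetHolds.lean`);
* Arapura 2022, Thm. 1.2 on the smooth part of a `p_g = 0` surface fibration
  (`Arapura2022_thm_1_2_smoothPart_pgZeroSurfaceFibration`) — proved in the Literature layer by the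
  MONODROMY ARGUMENT (`HodgeTheory/ArapuraSurfaceFibredFourfoldsSplitMonodromy.lean`,
  `Arapura2022_thm_1_2_smoothPart_pgZeroSurfaceFibration_holds_of_riemannExistence_of_globalInvariantCycles`)
  GRANTED exactly two classical named facts of the tree that are NOT yet theorems:
  `FundamentalGroup.riemannExistence_finiteCovering` (Riemann's existence theorem over `ℂ` in
  covering form, SGA1 XII Thm. 5.1) and `HodgeTheory.deligne_globalInvariantCycles` (Deligne's
  théorème de la partie fixe, *Hodge II* Thm. 4.1.1).

This file records the composition as ONE conditional theorem,
`stub_levelZeroNets_of_riemannExistence_of_globalInvariantCycles : riemannExistence_finiteCovering →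
deligne_globalInvariantCycles → LevelZeroNets`, so that the residue of the stub is machine-visible
on the crux item and its final closure is the one-liner
`theorem stub_levelZeroNets : LevelZeroNets := stub_levelZeroNets_of_riemannExistence_of_globalInvariantCycles
‹riemannExistence_finiteCovering› ‹deligne_globalInvariantCycles›` once the two facts are discharged.
No `sorry`, no new definition, no new named fact; the two open facts enter as hypotheses BY NAME.

## References

* [Arapura2022] D. Arapura, *Hodge cycles and the Leray filtration*, Pacific J. Math. 319 (2022)
  233–258, Thm. 1.2, Cor. 1.4, Cor. 1.5 and its proof (p. 5).
* [DeligneHodgeIII1974] P. Deligne, *Théorie de Hodge III*, Publ. Math. IHÉS 44 (1974), Cor. 8.2.8.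
* [DeligneHodgeII1971] P. Deligne, *Théorie de Hodge II*, Publ. Math. IHÉS 40 (1971), Thm. 4.1.1.
* [SGA1] A. Grothendieck, M. Raynaud, *Revêtements étales et groupe fondamental*, Exp. XII Thm. 5.1.
-/

-- `Summit.HodgeConjecture.HodgeConjecture.Theorems` is the mandated namespace (single-problem summit),
-- flagged by `linter.dupNamespace`; the lakefile turns the linter off tree-wide, restated here.
set_option linter.dupNamespace false

noncomputable section

open Literature.AlgebraicGeometry.HodgeTheory

namespace Summit.HodgeConjecture.HodgeConjecture.Theorems

/-- **`LevelZeroNets` (route item stmt-HodgeConjecture-11602) modulo Riemann existence and the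
global invariant cycle theorem** — the conditional closure of stub `stub_levelZeroNets` of line
`birth` of crux `FourfoldsGrantedK3Nets`: GRANTED Riemann's existence theorem over `ℂ` in covering
form (`FundamentalGroup.riemannExistence_finiteCovering`, SGA1 XII Thm. 5.1) and Deligne's théorème
de la partie fixe (`HodgeTheory.deligne_globalInvariantCycles`, *Hodge II* Thm. 4.1.1), for every
smooth projective complex fourfold `X` and `f : X ⟶ ℙ²` surjective on points whose fibres off a
proper Zariski-closed `T ⊊ ℙ²` are smooth projective surfaces with a Hodge model of `h^{2,0} = 0`,
`span {rational (2,2)-classes} ≤ algebraicClasses X 2 ⊔ span {rational (2,2)-classes vanishing off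
f⁻¹T' for some closed T' ≠ univ}`. Proof: `levelZeroNets_of_deligne_smoothPart` (Arapura 2022,
proof of Cor. 1.5 on the tree's carriers) fed with the tree's theorem
`Deligne1974_ker_restrictCompl_eq_iSup_range_complexGysin_holds` (*Hodge III* Cor. 8.2.8) and with
`Arapura2022_thm_1_2_smoothPart_pgZeroSurfaceFibration_holds_of_riemannExistence_of_globalInvariantCycles hRE hGIC`
(Arapura's Thm. 1.2 on the smooth part by the monodromy argument: generic smoothness, finite
monodromy of `p_g = 0` families, finite étale base change by Riemann existence, divisor classes by
the partie fixe and Lefschetz `(1,1)`). CONDITIONAL on exactly the two hypotheses `hRE`, `hGIC`.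
[cite: Arapura2022, Cor. 1.5 with Thm. 1.2 and proof of Cor. 1.5 (p. 5)]
[cite: DeligneHodgeIII1974, Cor. 8.2.8] [cite: DeligneHodgeII1971, Théorème 4.1.1]
[cite: SGA1, Exp. XII Thm. 5.1] -/
theorem stub_levelZeroNets_of_riemannExistence_of_globalInvariantCycles
    (hRE : Literature.AlgebraicGeometry.FundamentalGroup.riemannExistence_finiteCovering)
    (hGIC : Literature.AlgebraicGeometry.HodgeTheory.deligne_globalInvariantCycles) :
    Summit.HodgeConjecture.HodgeConjecture.Theses.NoetherLefschetzOneUp.LevelZeroNets :=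
  levelZeroNets_of_deligne_smoothPart Deligne1974_ker_restrictCompl_eq_iSup_range_complexGysin_holds
    (Arapura2022_thm_1_2_smoothPart_pgZeroSurfaceFibration_holds_of_riemannExistence_of_globalInvariantCycles
      hRE hGIC)

end Summit.HodgeConjecture.HodgeConjecture.Theorems

end
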